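import Literature.MathematicalPhysics.QuantumFieldTheory.Balaban1983to89.B14Claim283RAnalytic

/-!
# `Balaban1983to89.B14.Ineq244ChartFeed` — [Balaban1988Convergent] Theorem 2, inequality (2.44) p. 263: the 𝐑-side
# «and this yields the inequality (2.44)» (p. 283) ASSEMBLED END TO END for runs whose 𝐑-differences are given by
# per-domain analytic, gauge-invariant chart functionals obeying (2.31) — per-domain chart bound (`…Claim283RAnalytic`)
# ⟶ «z is an arbitrary point from X» regrouping ⟶ (1.26) of [II] per point (`…Thm2Assembly`) ⟶ `Rep244`/`PointDataR`
# ⟶ (2.44) with `R₁ = C·K₀(c₀, Δ)` EXPLICIT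

HONEST FRAMING (cell `lit-balaban`, verbatim): statement-level skeleton of published theorems with citation tags;
proofs where landed; nothing here is a claim about the Yang–Mills mass gap.

CITATION HEADER (lean-in-tree rule).  Source: T. Bałaban, *Convergent renormalization expansions for lattice gauge
theories*, Commun. Math. Phys. **119** (1988) 243–285, doi:10.1007/bf01217741 [Balaban1988Convergent] (cell paper
B14 = "[III]"; PDF held `paper:balaban1988-cmp119-convergent-renormalization`, journal page = PDF page + 242; renders
`run/shared/lean/pub/pub-balaban/b2b-balaban-ref1/pages/1988-cmp119-convergent-renormalization/…-pNNN-x2.png`):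
Theorem 2 (2.44) p. 263 [PDF 21], the last paragraph of its proof p. 283 [PDF 41], (2.31) p. 260 [PDF 18], the point
count p. 263; [II] = T. Bałaban, Commun. Math. Phys. **116** (1988) 1–22 [Balaban1988RG2Cluster], (1.26) p. 8;
[I] = T. Bałaban, Commun. Math. Phys. **109** (1987) 249–301 [Balaban1987RG1], (4.16)–(4.18) p. 285.
Mega-formalization `lit-balaban` (HOME `run/shared/lean/pub/lit-balaban/`), reader/typer unit `lit-balaban-r11`
(generation 11, fold owner of B14), SKELETON rows **B14.Thm2** (status cell), **B14.Claim@283R** (the 𝐑-side paragraph),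
**B14.Eq2.31**.  Imports the row's own `…B14Claim283RAnalytic` (gen 10; through it `…B14Claim283RBound`,
`…B14Thm2Assembly`, `…B12TreeDecay`, `…B14Sect3`, `…B14Thm2`) and uses their theorems BY NAME; modifies nothing;
NO `def`, no new `Prop`, no named fact (D-0026: theorems only).

THE PRINTED TEXT (verbatim).  (2.44) p. 263: *«Similarly, there exists an absolute constant R₁ such, that
|Σ_{X∈𝐃_j, X⊂Λ_j, X∩Ω≠∅}[𝐑^{(j)}(X, U_k) − 𝐑^{(j)}(X, 1)]| ≤ R₁g_j^{κ₀}Σ_{n=j}^{k}|Γ_n∩Ω| (2.44) for the regular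
configurations U_k. (In fact the constant R₁ can be taken as equal to 1 for g_j sufficiently small.)»*; p. 263, on the
volumes: *«The volumes are taken in the corresponding scales, i.e. |Γ_n∩Ω| means the number of points in the set
Γ_n∩Ω ⊂ T₁^{(n)}»*; p. 283 [PDF 41]: *«The inequality (2.44) for the functions 𝐑^{(j)} can be proved in an almost
identical way. We analyze these functions as above, but we stop at the identity (3.49), where 𝐄^{(2)}(X, x, y, z) is
replaced by 𝐑^{(2)}(X, x, y), and z is an arbitrary point from X. Now all the terms on the right-hand side can be
bounded by O(1)(LʲL⁻ⁿ)⁴g_j^{κ₀} exp(−κd_j(X)), and this yields the inequality (2.44). The proof of Theorem 2 is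
completed.»*; (2.31) p. 260: *«|𝐑^{(j)}(X, (𝐔, 𝐉))| ≦ g_j^{κ₀} exp(−κd_j(X))»* with (ii) analyticity and (iii) gauge
invariance p. 259; [II] (1.26) p. 8: *«Σ_{X∈𝐃_j, X⊃□′} exp(−κd_j(X)) ≤ O(1)»*.

WHAT THIS FILE PROVES (theorems only).  The three landed pieces of the 𝐑-side — (a) the per-domain chart bound with
NO lettered size `‖f(B) − f(0)‖ ≤ C(a, b, α)·σ⁴·g_j^{κ₀}·e^{−κd_j(X)}` (`…Claim283RAnalytic.diff_chart_norm_le_coupling_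
of_analytic`, gen 10), (b) the per-point summation over the domains above the cube of `z` by (1.26)
(`…Thm2Assembly.perPointR_of_domainBound`, gen 5), (c) the point summation `Rep244 ⇒ Ineq244`
(`…B14Sect3.ineq244_of_rep244`, gen 1) — are here COMPOSED into one statement, adding the one step print leaves to
the reader, *«z is an arbitrary point from X»*: the domain sum of (2.44) regrouped by an assignment `X ↦ z_X ∈ X`
(§1, `perPointR_of_subfamily`: a SUB-family `A ⊆ {X : X ⊃ □_z}` is bounded by the full (1.26) sum, the summands'
bounds being nonnegative; `rep244Clause_of_domainBounds`: the `Rep244` clause of one triple `(j, k, Ω)` from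
per-domain bounds, the domains already grouped by points; `rep244Clause_of_assignment`: the same with the left-hand side
LITERALLY `Σ_{X∈D} r(X)` over the printed index set `D = {X ∈ 𝐃_j : X ⊂ Λ_j, X∩Ω ≠ ∅}` and a CHOICE `X ↦ z_X` with
`□_{z_X} ⊂ X`, the regrouping `Σ_{X∈D} = Σ_z Σ_{X : z_X = z}` done here by `Finset.sum_fiberwise_of_maps_to`;
`pointDataR_of_domainBounds` / `pointDataR_of_assignments`: `PointDataR S L (C·K₀(c₀,Δ)) κ₀` for a run all of whose
triples are so represented).  §2 `domainTerm_le_of_chart`: the per-domain REAL term `r` (model: `𝐑^{(j)}(X, U_k) − 𝐑^{(j)}(X, 1)`,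
`|r| ≤ ‖f(B) − f(0)‖`) obeys `|r| ≤ C·σ⁴·g^{κ₀}·e^{−κd_j(X)}` for EVERY `C ≥ C(a, b, α)` = the explicit polynomial of
(a), with the field scalings of (I.4.16)–(I.4.18) in the form the 𝐑-side needs (Hölder gain `τ` set to `1` — print's
exponent in (2.44) is exactly 4).  §3 **`rep244Clause_of_charts`**: for ONE triple `(j, k, Ω)` — cubes/domains of
`𝐃_j` as a `CubeSystem` with the dimension-only constants `Δ, c₀` of (1.26), points `z ∈ Z` of scales `n_z ∈ [j, k]`
with the p. 263 count, an assignment of the domains to points (`A z ⊆ above □_z`), ONE gauge-invariant `C⁴`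
functional `ℰ_X` per domain whose chart around `1` is complex-analytic on `‖B‖ < α` and bounded there by
`g_j^{κ₀}e^{−κd_j(X)}` ((ii), (iii), (2.31)), ONE chart field `B_z` per point with its (I.4.16)–(I.4.18) pieces at
`σ_z = L^{j−n_z}`, and real terms `|r(z, X)| ≤ ‖ℰ_X(exp ρB_z) − ℰ_X(1)‖` summing to the left-hand side — the `Rep244`
clause holds with the constant `C·K₀(c₀, Δ)·g_j^{κ₀}`; `rep244Clause_of_charts_assignment`: the same in the assignment
form (left-hand side `Σ_{X∈D} r(X)`, chart field read at the chosen point `z_X`, functional hypotheses only for `X ∈ D`).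
§4 corollaries: (2.44) for one run (`ineq244_of_domainBounds`, `ineq244_of_assignments`: `B14Thm2.Ineq244 S (C·K₀) κ₀`)
and, for a FAMILY of runs with the same letters, the 𝐑-conjunct of `B14.Thm2Printed` with ONE `R₁ = c′` BEFORE the
run index (`thm2_Rconjunct_of_pointDataR`; print's «absolute constant R₁»).

HONEST SCOPE.  (1) As in the imported files: the chart hypotheses are (ii) + (iii) + (2.31) READ IN THE CHART
`B ↦ ℰ_X(exp ρB)` around the unit configuration, the radius `α`, the scaling constant `a` of (I.4.16)–(I.4.18), the
bracket bound `b` and `‖B_z‖ ≤ α/2` («for g_j sufficiently small») are letters/hypotheses; semisimple charge algebra.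
(2) The assignment `X ↦ z_X` («z is an arbitrary point from X»), the scales `n_z` (z ∈ Ω_{n}∖Ω_{n+1}) and the p. 263
point count `#{z of scale n} ≤ (L^{n−j})⁴|Γ_n∩Ω|` are hypotheses on the run's bookkeeping, exactly as in `B14Sect3.Rep244`
(gen 1) and `Thm2Assembly.PointDataE/R` (gen 5).  (3) Bałaban's concrete 𝐑^{(j)} on his configuration spaces is NOT
instantiated here (row B14.Thm2 head policy G.5-45 unchanged: this file shortens the remaining «one-carrier gluing» to
supplying these data); nothing about the Yang–Mills mass gap.

## References
* [Balaban1988Convergent] T. Bałaban, Commun. Math. Phys. 119 (1988) 243–285: Thm 2 (2.44) p.263; p.283; (2.31) p.260.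
* [Balaban1988RG2Cluster] T. Bałaban, Commun. Math. Phys. 116 (1988) 1–22 ([II]: (1.26) p.8).
* [Balaban1987RG1] T. Bałaban, Commun. Math. Phys. 109 (1987) 249–301 ([I]: (4.16)–(4.18) p.285).
-/

open Set Metric Filter
open scoped Topology BigOperators

namespace Literature.MathematicalPhysics.QuantumFieldTheory.Balaban1983to89.B14.Ineq244ChartFeed

open Literature.MathematicalPhysics.QuantumFieldTheory.Balaban1983to89
open Literature.MathematicalPhysics.QuantumFieldTheory.Balaban1983to89.B12TreeDecay

/-! ## §1. «z is an arbitrary point from X»: regrouping the domain sum by points; `Rep244` from per-domain bounds -/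

section Regroup

variable {Sy : LocDomainSys} (G : CubeSystem Sy)

/-- **Sub-family step**: if the domains of a finite family `A ⊆ {X ∈ 𝐃_j : X ⊃ □}` (the domains ASSIGNED to the point
`z` of the cube `□`, «z is an arbitrary point from X») each obey `|r(X)| ≤ c·s⁴·g^{κ₀}·exp(−κd_j(X))`, then
`|Σ_{X∈A} r(X)| ≤ c·K₀(c₀, Δ)·s⁴·g^{κ₀}` for `κ ≥ κ₀(c₀, Δ)` — the full sum over `{X ⊃ □}` of (1.26) dominates the
sub-family because the bounds are nonnegative (`…Thm2Assembly.perPointR_of_domainBound` applied to `r` extended by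
zero). [cite: Balaban1988Convergent, p.283; Balaban1988RG2Cluster, (1.26) p.8] -/
theorem perPointR_of_subfamily {Δ : ℕ} (hΔ : G.DegreeLE Δ) {c₀ : ℝ} (hV : G.VolumeLeaf c₀) {κ : ℝ}
    (hκ : kappa₀ c₀ Δ ≤ κ) {A : Finset Sy.Dom} {cz : G.Cube} (hA : A ⊆ G.above cz) {r : Sy.Dom → ℝ}
    {c s g : ℝ} {κ₀' : ℕ} (hc : 0 ≤ c) (hs : 0 ≤ s) (hg : 0 ≤ g)
    (hr : ∀ X ∈ A, |r X| ≤ c * s ^ 4 * g ^ κ₀' * Real.exp (-κ * Sy.dj X)) :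
    |∑ X ∈ A, r X| ≤ c * K₀ c₀ Δ * s ^ 4 * g ^ κ₀' := by
  classical
  set r' : Sy.Dom → ℝ := fun X => if X ∈ A then r X else 0 with hr'_def
  have hsum : ∑ X ∈ G.above cz, r' X = ∑ X ∈ A, r X := by
    rw [← Finset.sum_subset hA (f := r') (fun X _ hXA => by simp [hr'_def, hXA])]
    exact Finset.sum_congr rfl fun X hX => by simp [hr'_def, hX]
  have hb : ∀ X ∈ G.above cz, |r' X| ≤ c * s ^ 4 * g ^ κ₀' * Real.exp (-κ * Sy.dj X) := by
    intro X _
    by_cases hX : X ∈ A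
    · have e : r' X = r X := by simp [hr'_def, hX]
      rw [e]
      exact hr X hX
    · have e : r' X = 0 := by simp [hr'_def, hX]
      rw [e, abs_zero]
      positivity
  rw [← hsum]
  exact Thm2Assembly.perPointR_of_domainBound G hΔ hV hκ hc hs hg cz hb

/-- **The `Rep244` clause of ONE triple `(j, k, Ω)` from per-domain bounds** (p. 283 ⇒ the hypothesis of
`B14Sect3.ineq244_of_rep244` for this triple): points `z ∈ Z` (encoded by naturals, as in `B14Sect3.Rep244`) of scales
`n_z = sc z ∈ [j, k]`, cubes `□_z = cz z`, assigned domain families `A z ⊆ {X ⊃ □_z}`, per-domain terms with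
`|r(z, X)| ≤ C·(L^{j−n_z})⁴·g^{κ₀}·exp(−κd_j(X))` («bounded by O(1)(LʲL⁻ⁿ)⁴g_j^{κ₀}exp(−κd_j(X))»), the left-hand side
`R = Σ_z Σ_{X∈A z} r(z, X)` and the p. 263 point count `#{z : n_z = n} ≤ (L^{n−j})⁴·γ_n`: then `R = Σ_z t_z` with
`|t_z| ≤ (C·K₀(c₀,Δ)·g^{κ₀})·(L^{j−n_z})⁴`. [cite: Balaban1988Convergent, p.283, (2.44) p.263;
Balaban1988RG2Cluster, (1.26) p.8] -/
theorem rep244Clause_of_domainBounds {Δ : ℕ} (hΔ : G.DegreeLE Δ) {c₀ : ℝ} (hV : G.VolumeLeaf c₀) {κ : ℝ}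
    (hκ : kappa₀ c₀ Δ ≤ κ) {C L g : ℝ} {κ₀' : ℕ} (hC : 0 ≤ C) (hL : 0 < L) (hg : 0 ≤ g) {j k : ℕ}
    (Z : Finset ℕ) (sc : ℕ → ℕ) (hsc : ∀ z ∈ Z, j ≤ sc z ∧ sc z ≤ k) (cz : ℕ → G.Cube)
    (A : ℕ → Finset Sy.Dom) (hA : ∀ z ∈ Z, A z ⊆ G.above (cz z)) (r : ℕ → Sy.Dom → ℝ)
    (hr : ∀ z ∈ Z, ∀ X ∈ A z,
      |r z X| ≤ C * (L ^ ((j : ℝ) - sc z)) ^ 4 * g ^ κ₀' * Real.exp (-κ * Sy.dj X))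
    {R : ℝ} (hR : R = ∑ z ∈ Z, ∑ X ∈ A z, r z X) {γ : ℕ → ℝ}
    (hcount : ∀ n, ((Z.filter (fun z => sc z = n)).card : ℝ) ≤ (L ^ ((n : ℝ) - j)) ^ (4 : ℝ) * γ n) :
    ∃ (Z' : Finset ℕ) (sc' : ℕ → ℕ) (t : ℕ → ℝ), R = ∑ z ∈ Z', t z ∧ (∀ z ∈ Z', j ≤ sc' z ∧ sc' z ≤ k) ∧
      (∀ z ∈ Z', |t z| ≤ (C * K₀ c₀ Δ * g ^ κ₀') * (L ^ ((j : ℝ) - sc' z)) ^ (4 : ℝ)) ∧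
      (∀ n, ((Z'.filter (fun z => sc' z = n)).card : ℝ) ≤ (L ^ ((n : ℝ) - j)) ^ (4 : ℝ) * γ n) := by
  refine ⟨Z, sc, fun z => ∑ X ∈ A z, r z X, hR, hsc, fun z hz => ?_, hcount⟩
  have hs : 0 ≤ L ^ ((j : ℝ) - sc z) := Real.rpow_nonneg hL.le _
  have h := perPointR_of_subfamily G hΔ hV hκ (hA z hz) hC hs hg (hr z hz)
  have e : (L ^ ((j : ℝ) - sc z)) ^ (4 : ℝ) = (L ^ ((j : ℝ) - sc z)) ^ 4 := by
    exact_mod_cast Real.rpow_natCast (L ^ ((j : ℝ) - sc z)) 4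
  rw [e]
  calc |∑ X ∈ A z, r z X| ≤ C * K₀ c₀ Δ * (L ^ ((j : ℝ) - sc z)) ^ 4 * g ^ κ₀' := h
    _ = (C * K₀ c₀ Δ * g ^ κ₀') * (L ^ ((j : ℝ) - sc z)) ^ 4 := by ring

/-- **«z is an arbitrary point from X», literally**: the left-hand side of (2.44) as the sum over its printed index set
`D = {X ∈ 𝐃_j : X ⊂ Λ_j, X∩Ω ≠ ∅}` with a CHOICE `X ↦ z_X` of a point whose cube lies in `X` (`□_{z_X} ∈ cubes X`), all
chosen points inside a finite set `Z` of points with scales `n_z ∈ [j, k]` and the p. 263 count; per-domain bounds at the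
scale of the chosen point, `|r(X)| ≤ C·(L^{j−n_{z_X}})⁴·g^{κ₀}·exp(−κd_j(X))`.  The regrouping `Σ_{X∈D} = Σ_{z∈Z}Σ_{X : z_X = z}`
(`Finset.sum_fiberwise_of_maps_to`) and `rep244Clause_of_domainBounds` give the `Rep244` clause for `Σ_{X∈D} r(X)`.
[cite: Balaban1988Convergent, p.283, (2.44) p.263; Balaban1988RG2Cluster, (1.26) p.8] -/
theorem rep244Clause_of_assignment {Δ : ℕ} (hΔ : G.DegreeLE Δ) {c₀ : ℝ} (hV : G.VolumeLeaf c₀) {κ : ℝ}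
    (hκ : kappa₀ c₀ Δ ≤ κ) {C L g : ℝ} {κ₀' : ℕ} (hC : 0 ≤ C) (hL : 0 < L) (hg : 0 ≤ g) {j k : ℕ}
    (D : Finset Sy.Dom) (zOf : Sy.Dom → ℕ) (Z : Finset ℕ) (hZ : ∀ X ∈ D, zOf X ∈ Z) (sc : ℕ → ℕ)
    (hsc : ∀ z ∈ Z, j ≤ sc z ∧ sc z ≤ k) (cz : ℕ → G.Cube) (hcz : ∀ X ∈ D, cz (zOf X) ∈ G.cubes X)
    (r : Sy.Dom → ℝ)
    (hr : ∀ X ∈ D, |r X| ≤ C * (L ^ ((j : ℝ) - sc (zOf X))) ^ 4 * g ^ κ₀' * Real.exp (-κ * Sy.dj X))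
    {γ : ℕ → ℝ} (hcount : ∀ n, ((Z.filter (fun z => sc z = n)).card : ℝ) ≤ (L ^ ((n : ℝ) - j)) ^ (4 : ℝ) * γ n) :
    ∃ (Z' : Finset ℕ) (sc' : ℕ → ℕ) (t : ℕ → ℝ), ∑ X ∈ D, r X = ∑ z ∈ Z', t z ∧
      (∀ z ∈ Z', j ≤ sc' z ∧ sc' z ≤ k) ∧
      (∀ z ∈ Z', |t z| ≤ (C * K₀ c₀ Δ * g ^ κ₀') * (L ^ ((j : ℝ) - sc' z)) ^ (4 : ℝ)) ∧
      (∀ n, ((Z'.filter (fun z => sc' z = n)).card : ℝ) ≤ (L ^ ((n : ℝ) - j)) ^ (4 : ℝ) * γ n) := by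
  classical
  have hR : ∑ X ∈ D, r X = ∑ z ∈ Z, ∑ X ∈ D.filter (fun X => zOf X = z), r X :=
    (Finset.sum_fiberwise_of_maps_to hZ _).symm
  refine rep244Clause_of_domainBounds G hΔ hV hκ hC hL hg Z sc hsc cz (fun z => D.filter (fun X => zOf X = z))
    (fun z _ X hX => ?_) (fun _ X => r X) (fun z _ X hX => ?_) hR hcount
  · obtain ⟨hXD, hXz⟩ := Finset.mem_filter.1 hX
    rw [CubeSystem.mem_above, ← hXz]
    exact hcz X hXD
  · obtain ⟨hXD, hXz⟩ := Finset.mem_filter.1 hX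
    rw [← hXz]
    exact hr X hXD

end Regroup

/-- **`PointDataR` (= `B14Sect3.Rep244`) for ONE RUN from per-domain bounds**: if EVERY triple `(j, k, Ω)` of the run
`S` is represented as in `rep244Clause_of_domainBounds` — on the localization domains of `𝐃_j` with a cube system of
degree `≤ Δ` and volume leaf `c₀` (the dimension-only constants of (1.26)), `κ ≥ κ₀(c₀, Δ)`, with the SAME `C`, the
coupling `g_j = S.flow.g j` and the volumes `|Γ_n∩Ω| = S.gammaVol n Ω` — then `Thm2Assembly.PointDataR S L (C·K₀(c₀,Δ)) κ₀`.
[cite: Balaban1988Convergent, p.283, (2.44) p.263; Balaban1988RG2Cluster, (1.26) p.8] -/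
theorem pointDataR_of_domainBounds (S : B14.Sect2Data) {Δ : ℕ} {c₀ κ C L : ℝ} {κ₀ : ℕ} (hC : 0 ≤ C)
    (hL : 0 < L) (hg : ∀ j, 0 ≤ S.flow.g j)
    (h : ∀ j k ω, 1 ≤ j → j ≤ k → k ≤ S.K →
      ∃ (Sy : LocDomainSys) (G : CubeSystem Sy) (_ : G.DegreeLE Δ) (_ : G.VolumeLeaf c₀) (_ : kappa₀ c₀ Δ ≤ κ)
        (Z : Finset ℕ) (sc : ℕ → ℕ) (cz : ℕ → G.Cube) (A : ℕ → Finset Sy.Dom) (r : ℕ → Sy.Dom → ℝ),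
        S.rTerm j k ω = ∑ z ∈ Z, ∑ X ∈ A z, r z X ∧ (∀ z ∈ Z, j ≤ sc z ∧ sc z ≤ k) ∧
        (∀ z ∈ Z, A z ⊆ G.above (cz z)) ∧
        (∀ z ∈ Z, ∀ X ∈ A z,
          |r z X| ≤ C * (L ^ ((j : ℝ) - sc z)) ^ 4 * (S.flow.g j) ^ κ₀ * Real.exp (-κ * Sy.dj X)) ∧
        (∀ n, ((Z.filter (fun z => sc z = n)).card : ℝ) ≤ (L ^ ((n : ℝ) - j)) ^ (4 : ℝ) * S.gammaVol n ω)) :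
    Thm2Assembly.PointDataR S L (C * K₀ c₀ Δ) κ₀ := by
  intro j k ω hj hjk hkK
  obtain ⟨Sy, G, hΔ, hV, hκ, Z, sc, cz, A, r, hsum, hsc, hA, hr, hcount⟩ := h j k ω hj hjk hkK
  obtain ⟨Z', sc', t, hR, hsc', ht, hcount'⟩ :=
    rep244Clause_of_domainBounds G hΔ hV hκ hC hL (hg j) Z sc hsc cz A hA r hr hsum hcount
  exact ⟨Z', sc', t, hR, hsc', ht, hcount'⟩

/-- **`PointDataR` for ONE RUN from per-domain bounds in the ASSIGNMENT form** (every triple `(j, k, Ω)` of `S`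
represented as in `rep244Clause_of_assignment`: `S.rTerm j k Ω = Σ_{X∈D} r(X)` over the printed index set with a choice
`X ↦ z_X`, `□_{z_X} ⊂ X`). [cite: Balaban1988Convergent, p.283, (2.44) p.263; Balaban1988RG2Cluster, (1.26) p.8] -/
theorem pointDataR_of_assignments (S : B14.Sect2Data) {Δ : ℕ} {c₀ κ C L : ℝ} {κ₀ : ℕ} (hC : 0 ≤ C)
    (hL : 0 < L) (hg : ∀ j, 0 ≤ S.flow.g j)
    (h : ∀ j k ω, 1 ≤ j → j ≤ k → k ≤ S.K →
      ∃ (Sy : LocDomainSys) (G : CubeSystem Sy) (_ : G.DegreeLE Δ) (_ : G.VolumeLeaf c₀) (_ : kappa₀ c₀ Δ ≤ κ)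
        (D : Finset Sy.Dom) (zOf : Sy.Dom → ℕ) (Z : Finset ℕ) (sc : ℕ → ℕ) (cz : ℕ → G.Cube) (r : Sy.Dom → ℝ),
        S.rTerm j k ω = ∑ X ∈ D, r X ∧ (∀ X ∈ D, zOf X ∈ Z) ∧ (∀ z ∈ Z, j ≤ sc z ∧ sc z ≤ k) ∧
        (∀ X ∈ D, cz (zOf X) ∈ G.cubes X) ∧
        (∀ X ∈ D, |r X| ≤ C * (L ^ ((j : ℝ) - sc (zOf X))) ^ 4 * (S.flow.g j) ^ κ₀ * Real.exp (-κ * Sy.dj X)) ∧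
        (∀ n, ((Z.filter (fun z => sc z = n)).card : ℝ) ≤ (L ^ ((n : ℝ) - j)) ^ (4 : ℝ) * S.gammaVol n ω)) :
    Thm2Assembly.PointDataR S L (C * K₀ c₀ Δ) κ₀ := by
  intro j k ω hj hjk hkK
  obtain ⟨Sy, G, hΔ, hV, hκ, D, zOf, Z, sc, cz, r, hsum, hZ, hsc, hcz, hr, hcount⟩ := h j k ω hj hjk hkK
  obtain ⟨Z', sc', t, hR, hsc', ht, hcount'⟩ :=
    rep244Clause_of_assignment G hΔ hV hκ hC hL (hg j) D zOf Z hZ sc hsc cz hcz r hr hcount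
  exact ⟨Z', sc', t, hsum.trans hR, hsc', ht, hcount'⟩

/-! ## §2. The per-domain real term from the chart bound of `…Claim283RAnalytic` -/

section Chart

open NormedSpace (exp)

variable {𝔄 : Type*} [NormedRing 𝔄] [NormedAlgebra ℝ 𝔄] [CompleteSpace 𝔄] {Λ T : Type*} [Fintype Λ] [Fintype T]
  [AddCommGroup T] {V : Type*} [NormedAddCommGroup V] [NormedSpace ℂ V] {F : Type*} [NormedAddCommGroup F]
  [NormedSpace ℂ F] [CompleteSpace F]

/-- The explicit chart constant of `…Claim283RAnalytic.diff_chart_norm_le_coupling_of_analytic` is nonnegative.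
[folklore] -/
private theorem chartPoly_nonneg {a b α : ℝ} (ha : 0 ≤ a) (hb0 : 0 ≤ b) (hα : 0 < α) :
    0 ≤ ((2 : ℝ)⁻¹ * (4 / α) ^ 2 * (a + (2 : ℝ)⁻¹ * b * a ^ 2) ^ 2
          + (3 / 2 : ℝ) * (4 / α) ^ 2 * a ^ 2 + (10 / 3 : ℝ) * (4 / α) ^ 2 * a ^ 3 * b
          + (9 / 8 : ℝ) * (4 / α) ^ 2 * a ^ 4 * b ^ 2
          + (5 / 2 : ℝ) * (6 / α) ^ 3 * a ^ 3 + (33 / 8 : ℝ) * (6 / α) ^ 3 * a ^ 4 * b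
          + (9 / 4 : ℝ) * (8 / α) ^ 4 * a ^ 4 + 243 * (32 / α ^ 5) * a ^ 5) := by
  positivity

-- (the quadruply nested operator space over the iterated `Pi` type: one more level of pending instance synthesis)
set_option maxSynthPendingDepth 3 in
/-- **The per-domain term of (2.44), a REAL number**: in the chart `f(B) = ℰ(exp ρB)` of a gauge-invariant `C⁴`
functional with semisimple charge algebra, complex-analytic on `‖B‖ < α` and bounded there by `g^{κ₀}exp(−κd_j(X))`
((ii), (iii), (2.31)), with the field pieces of (I.4.16)–(I.4.18) at `σ = LʲL⁻ⁿ` — `‖B(z)‖, ‖λ_z‖ ≤ aσ`,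
`‖B(·, z)‖ ≤ aσ²`, `‖B − B(z) − B(·, z)‖ ≤ aσ²` (the Hölder gain of (I.4.18) is not needed on the 𝐑-side and is dropped:
`τ = 1` in the imported theorem) — and `‖B‖ ≤ α/2`, ANY real `r` with `|r| ≤ ‖f(B) − f(0)‖` (model:
`r = 𝐑^{(j)}(X, U_k) − 𝐑^{(j)}(X, 1)`) obeys `|r| ≤ C·σ⁴·g^{κ₀}·exp(−κd_j(X))` for EVERY `C` at least the explicit chart
constant `C(a, b, α)` of `…Claim283RAnalytic.diff_chart_norm_le_coupling_of_analytic` — «bounded by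
O(1)(LʲL⁻ⁿ)⁴g_j^{κ₀}exp(−κd_j(X))». [cite: Balaban1988Convergent, p.283, (2.31) p.260; Balaban1987RG1, (4.16)–(4.18) p.285] -/
theorem domainTerm_le_of_chart {𝔤 : Type*} [LieRing 𝔤] [LieAlgebra ℝ 𝔤] [FiniteDimensional ℝ 𝔤]
    [LieAlgebra.IsSemisimple ℝ 𝔤] (eV : V ≃ₗ[ℝ] 𝔤) {ℰ : (Λ → T → 𝔄) → F} (e : Λ → T) (ρ : V →L[ℝ] 𝔄)
    (hρ : ∀ a b : V, ρ (eV.symm ⁅eV a, eV b⁆) = ρ a * ρ b - ρ b * ρ a) (hℰ : ContDiffAt ℝ 4 ℰ 1)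
    (h47 : ∀ lam : T → V, ∀ᶠ W in 𝓝 (1 : Λ → T → 𝔄), ∀ᶠ t in 𝓝 (0 : ℝ),
      ℰ (fun ν x => exp (t • ρ (lam x)) * W ν x * exp (-(t • ρ (lam (x + e ν))))) = ℰ W)
    {α : ℝ} (hα : 0 < α) {g κ dX : ℝ} (hg : 0 ≤ g) {κ₀ : ℕ}
    (hf : AnalyticOnNhd ℂ (fun A : Λ → T → V => ℰ (fun ν y => exp (ρ (A ν y)))) (ball 0 α))
    (hS : ∀ A ∈ ball (0 : Λ → T → V) α, ‖ℰ (fun ν y => exp (ρ (A ν y)))‖ ≤ g ^ κ₀ * Real.exp (-κ * dX))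
    {b : ℝ} (hb0 : 0 ≤ b) (hb : ∀ x y : V, ‖eV.symm ⁅eV x, eV y⁆‖ ≤ b * ‖x‖ * ‖y‖)
    (lam : T → V) (c ℓ B : Λ → T → V) (hc : ∀ ν y, lam (y + e ν) - lam y = c ν y)
    {a σ : ℝ} (ha : 0 ≤ a) (hσ0 : 0 ≤ σ) (hσ1 : σ ≤ 1) (hcn : ‖c‖ ≤ a * σ) (hlam : ‖lam‖ ≤ a * σ)
    (hℓ : ‖ℓ‖ ≤ a * σ ^ 2) (hr : ‖B - c - ℓ‖ ≤ a * σ ^ 2) (hBα : ‖B‖ ≤ α / 2) {C : ℝ}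
    (hC : (2 : ℝ)⁻¹ * (4 / α) ^ 2 * (a + (2 : ℝ)⁻¹ * b * a ^ 2) ^ 2
          + (3 / 2 : ℝ) * (4 / α) ^ 2 * a ^ 2 + (10 / 3 : ℝ) * (4 / α) ^ 2 * a ^ 3 * b
          + (9 / 8 : ℝ) * (4 / α) ^ 2 * a ^ 4 * b ^ 2
          + (5 / 2 : ℝ) * (6 / α) ^ 3 * a ^ 3 + (33 / 8 : ℝ) * (6 / α) ^ 3 * a ^ 4 * b
          + (9 / 4 : ℝ) * (8 / α) ^ 4 * a ^ 4 + 243 * (32 / α ^ 5) * a ^ 5 ≤ C)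
    {r : ℝ} (hrX : |r| ≤ ‖ℰ (fun ν y => exp (ρ (B ν y))) - ℰ (fun ν y => exp (ρ ((0 : Λ → T → V) ν y)))‖) :
    |r| ≤ C * σ ^ 4 * g ^ κ₀ * Real.exp (-κ * dX) := by
  have hr' : ‖B - c - ℓ‖ ≤ a * σ ^ 2 * 1 := by rw [mul_one]; exact hr
  have h := Claim283RAnalytic.diff_chart_norm_le_coupling_of_analytic eV e ρ hρ hℰ h47 hα hf hS hb0 hb lam c ℓ B hc
    ha hσ0 hσ1 hσ1 le_rfl hcn hlam hℓ hr' hBα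
  have hw : 0 ≤ σ ^ 4 * g ^ κ₀ * Real.exp (-κ * dX) :=
    mul_nonneg (mul_nonneg (pow_nonneg hσ0 4) (pow_nonneg hg _)) (Real.exp_nonneg _)
  have key := mul_le_mul_of_nonneg_right hC hw
  refine hrX.trans (h.trans ?_)
  linarith [key]

/-! ## §3. The `Rep244` clause of one triple `(j, k, Ω)` from a family of per-domain charts -/

-- (the quadruply nested operator space over the iterated `Pi` type: one more level of pending instance synthesis)
set_option maxSynthPendingDepth 3 in
/-- **(2.44) for ONE triple `(j, k, Ω)`, END TO END from per-domain analytic gauge-invariant charts** («We analyze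
these functions as above, but we stop at the identity (3.49) … z is an arbitrary point from X … all the terms … can
be bounded by O(1)(LʲL⁻ⁿ)⁴g_j^{κ₀}exp(−κd_j(X)), and this yields the inequality (2.44)»).  DATA of the triple: the
localization domains `𝐃_j` over a cube system of degree `≤ Δ` with volume leaf `c₀` and `κ ≥ κ₀(c₀, Δ)` ((1.26) of
[II]); points `z ∈ Z` of scales `n_z = sc z ∈ [j, k]` with cubes `□_z` and the p. 263 count
`#{z : n_z = n} ≤ (L^{n−j})⁴γ_n`; for each `z` a finite family `A z ⊆ {X ⊃ □_z}` of domains ASSIGNED to `z`; ONE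
functional `ℰ_X` per domain — `C⁴` at `1`, gauge invariant near `1` ((iii)), its chart `B ↦ ℰ_X(exp ρB)`
complex-analytic on `‖B‖ < α` and bounded there by `g^{κ₀}exp(−κd_j(X))` ((ii) + (2.31)) —; ONE chart field `B_z` per
point with its (I.4.16)–(I.4.18) pieces `λ_z, c_z = ∂λ_z, ℓ_z` at `σ_z = L^{j−n_z}` (`L ≥ 1`) and `‖B_z‖ ≤ α/2`; real
terms `|r(z, X)| ≤ ‖ℰ_X(exp ρB_z) − ℰ_X(1)‖` (model: `𝐑^{(j)}(X, U_k) − 𝐑^{(j)}(X, 1)` read in the `z`-adapted gauge, the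
same number in every gauge by (iii)) with `R = Σ_z Σ_{X∈A z} r(z, X)` (the left-hand side of (2.44) without the
absolute value).  CONCLUSION: the `B14Sect3.Rep244` clause for `R` with the constant `C·K₀(c₀, Δ)·g^{κ₀}`, `C` any
number at least the explicit chart constant `C(a, b, α)`. [cite: Balaban1988Convergent, p.283, (2.44) p.263, (2.31)
p.260; Balaban1988RG2Cluster, (1.26) p.8; Balaban1987RG1, (4.16)–(4.18) p.285] -/
theorem rep244Clause_of_charts
    {Sy : LocDomainSys} (G : CubeSystem Sy) {Δ : ℕ} (hΔ : G.DegreeLE Δ) {c₀ : ℝ} (hV : G.VolumeLeaf c₀) {κ : ℝ}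
    (hκ : kappa₀ c₀ Δ ≤ κ)
    {𝔤 : Type*} [LieRing 𝔤] [LieAlgebra ℝ 𝔤] [FiniteDimensional ℝ 𝔤] [LieAlgebra.IsSemisimple ℝ 𝔤]
    (eV : V ≃ₗ[ℝ] 𝔤) (e : Λ → T) (ρ : V →L[ℝ] 𝔄)
    (hρ : ∀ a b : V, ρ (eV.symm ⁅eV a, eV b⁆) = ρ a * ρ b - ρ b * ρ a)
    {α : ℝ} (hα : 0 < α) {b : ℝ} (hb0 : 0 ≤ b) (hb : ∀ x y : V, ‖eV.symm ⁅eV x, eV y⁆‖ ≤ b * ‖x‖ * ‖y‖)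
    {a : ℝ} (ha : 0 ≤ a) {C : ℝ}
    (hC : (2 : ℝ)⁻¹ * (4 / α) ^ 2 * (a + (2 : ℝ)⁻¹ * b * a ^ 2) ^ 2
          + (3 / 2 : ℝ) * (4 / α) ^ 2 * a ^ 2 + (10 / 3 : ℝ) * (4 / α) ^ 2 * a ^ 3 * b
          + (9 / 8 : ℝ) * (4 / α) ^ 2 * a ^ 4 * b ^ 2
          + (5 / 2 : ℝ) * (6 / α) ^ 3 * a ^ 3 + (33 / 8 : ℝ) * (6 / α) ^ 3 * a ^ 4 * b
          + (9 / 4 : ℝ) * (8 / α) ^ 4 * a ^ 4 + 243 * (32 / α ^ 5) * a ^ 5 ≤ C)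
    {L g : ℝ} (hL : 1 ≤ L) (hg : 0 ≤ g) {κ₀ j k : ℕ}
    (Z : Finset ℕ) (sc : ℕ → ℕ) (hsc : ∀ z ∈ Z, j ≤ sc z ∧ sc z ≤ k) (cz : ℕ → G.Cube)
    (A : ℕ → Finset Sy.Dom) (hA : ∀ z ∈ Z, A z ⊆ G.above (cz z))
    (ℰ : Sy.Dom → (Λ → T → 𝔄) → F) (hℰ : ∀ X, ContDiffAt ℝ 4 (ℰ X) 1)
    (h47 : ∀ X, ∀ lam' : T → V, ∀ᶠ W in 𝓝 (1 : Λ → T → 𝔄), ∀ᶠ t in 𝓝 (0 : ℝ),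
      ℰ X (fun ν x => exp (t • ρ (lam' x)) * W ν x * exp (-(t • ρ (lam' (x + e ν))))) = ℰ X W)
    (hf : ∀ X, AnalyticOnNhd ℂ (fun A' : Λ → T → V => ℰ X (fun ν y => exp (ρ (A' ν y)))) (ball 0 α))
    (hS : ∀ X, ∀ A' ∈ ball (0 : Λ → T → V) α,
      ‖ℰ X (fun ν y => exp (ρ (A' ν y)))‖ ≤ g ^ κ₀ * Real.exp (-κ * Sy.dj X))
    (lam : ℕ → T → V) (c ℓ B : ℕ → Λ → T → V) (hc : ∀ z ∈ Z, ∀ ν y, lam z (y + e ν) - lam z y = c z ν y)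
    (hcn : ∀ z ∈ Z, ‖c z‖ ≤ a * L ^ ((j : ℝ) - sc z)) (hlam : ∀ z ∈ Z, ‖lam z‖ ≤ a * L ^ ((j : ℝ) - sc z))
    (hℓ : ∀ z ∈ Z, ‖ℓ z‖ ≤ a * (L ^ ((j : ℝ) - sc z)) ^ 2)
    (hrB : ∀ z ∈ Z, ‖B z - c z - ℓ z‖ ≤ a * (L ^ ((j : ℝ) - sc z)) ^ 2) (hBα : ∀ z ∈ Z, ‖B z‖ ≤ α / 2)
    (r : ℕ → Sy.Dom → ℝ)
    (hrX : ∀ z ∈ Z, ∀ X ∈ A z,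
      |r z X| ≤ ‖ℰ X (fun ν y => exp (ρ (B z ν y))) - ℰ X (fun ν y => exp (ρ ((0 : Λ → T → V) ν y)))‖)
    {R : ℝ} (hR : R = ∑ z ∈ Z, ∑ X ∈ A z, r z X) {γ : ℕ → ℝ}
    (hcount : ∀ n, ((Z.filter (fun z => sc z = n)).card : ℝ) ≤ (L ^ ((n : ℝ) - j)) ^ (4 : ℝ) * γ n) :
    ∃ (Z' : Finset ℕ) (sc' : ℕ → ℕ) (t : ℕ → ℝ), R = ∑ z ∈ Z', t z ∧ (∀ z ∈ Z', j ≤ sc' z ∧ sc' z ≤ k) ∧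
      (∀ z ∈ Z', |t z| ≤ (C * K₀ c₀ Δ * g ^ κ₀) * (L ^ ((j : ℝ) - sc' z)) ^ (4 : ℝ)) ∧
      (∀ n, ((Z'.filter (fun z => sc' z = n)).card : ℝ) ≤ (L ^ ((n : ℝ) - j)) ^ (4 : ℝ) * γ n) := by
  have hC0 : 0 ≤ C := (chartPoly_nonneg ha hb0 hα).trans hC
  have hL0 : 0 < L := lt_of_lt_of_le one_pos hL
  refine rep244Clause_of_domainBounds G hΔ hV hκ hC0 hL0 hg Z sc hsc cz A hA r (fun z hz X hX => ?_) hR hcount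
  have hσ0 : 0 ≤ L ^ ((j : ℝ) - sc z) := Real.rpow_nonneg hL0.le _
  have hσ1 : L ^ ((j : ℝ) - sc z) ≤ 1 := by
    apply Real.rpow_le_one_of_one_le_of_nonpos hL
    have : (j : ℝ) ≤ sc z := by exact_mod_cast (hsc z hz).1
    linarith
  have h := domainTerm_le_of_chart eV e ρ hρ (hℰ X) (h47 X) hα hg (hf X) (hS X) hb0 hb (lam z) (c z) (ℓ z) (B z)
    (hc z hz) ha hσ0 hσ1 (hcn z hz) (hlam z hz) (hℓ z hz) (hrB z hz) (hBα z hz) hC (hrX z hz X hX)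
  exact h

-- (the quadruply nested operator space over the iterated `Pi` type: one more level of pending instance synthesis)
set_option maxSynthPendingDepth 3 in
/-- **(2.44) for ONE triple, charts in the ASSIGNMENT form** (the same as `rep244Clause_of_charts`, with the left-hand
side given literally as `Σ_{X∈D} r(X)` over the printed index set and a choice `X ↦ z_X` with `□_{z_X} ⊂ X`, the chart
field read at the chosen point: `|r(X)| ≤ ‖ℰ_X(exp ρB_{z_X}) − ℰ_X(1)‖`). [cite: Balaban1988Convergent, p.283, (2.44)
p.263, (2.31) p.260; Balaban1988RG2Cluster, (1.26) p.8; Balaban1987RG1, (4.16)–(4.18) p.285] -/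
theorem rep244Clause_of_charts_assignment
    {Sy : LocDomainSys} (G : CubeSystem Sy) {Δ : ℕ} (hΔ : G.DegreeLE Δ) {c₀ : ℝ} (hV : G.VolumeLeaf c₀) {κ : ℝ}
    (hκ : kappa₀ c₀ Δ ≤ κ)
    {𝔤 : Type*} [LieRing 𝔤] [LieAlgebra ℝ 𝔤] [FiniteDimensional ℝ 𝔤] [LieAlgebra.IsSemisimple ℝ 𝔤]
    (eV : V ≃ₗ[ℝ] 𝔤) (e : Λ → T) (ρ : V →L[ℝ] 𝔄)
    (hρ : ∀ a b : V, ρ (eV.symm ⁅eV a, eV b⁆) = ρ a * ρ b - ρ b * ρ a)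
    {α : ℝ} (hα : 0 < α) {b : ℝ} (hb0 : 0 ≤ b) (hb : ∀ x y : V, ‖eV.symm ⁅eV x, eV y⁆‖ ≤ b * ‖x‖ * ‖y‖)
    {a : ℝ} (ha : 0 ≤ a) {C : ℝ}
    (hC : (2 : ℝ)⁻¹ * (4 / α) ^ 2 * (a + (2 : ℝ)⁻¹ * b * a ^ 2) ^ 2
          + (3 / 2 : ℝ) * (4 / α) ^ 2 * a ^ 2 + (10 / 3 : ℝ) * (4 / α) ^ 2 * a ^ 3 * b
          + (9 / 8 : ℝ) * (4 / α) ^ 2 * a ^ 4 * b ^ 2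
          + (5 / 2 : ℝ) * (6 / α) ^ 3 * a ^ 3 + (33 / 8 : ℝ) * (6 / α) ^ 3 * a ^ 4 * b
          + (9 / 4 : ℝ) * (8 / α) ^ 4 * a ^ 4 + 243 * (32 / α ^ 5) * a ^ 5 ≤ C)
    {L g : ℝ} (hL : 1 ≤ L) (hg : 0 ≤ g) {κ₀ j k : ℕ}
    (D : Finset Sy.Dom) (zOf : Sy.Dom → ℕ) (Z : Finset ℕ) (hZ : ∀ X ∈ D, zOf X ∈ Z) (sc : ℕ → ℕ)
    (hsc : ∀ z ∈ Z, j ≤ sc z ∧ sc z ≤ k) (cz : ℕ → G.Cube) (hcz : ∀ X ∈ D, cz (zOf X) ∈ G.cubes X)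
    (ℰ : Sy.Dom → (Λ → T → 𝔄) → F) (hℰ : ∀ X ∈ D, ContDiffAt ℝ 4 (ℰ X) 1)
    (h47 : ∀ X ∈ D, ∀ lam' : T → V, ∀ᶠ W in 𝓝 (1 : Λ → T → 𝔄), ∀ᶠ t in 𝓝 (0 : ℝ),
      ℰ X (fun ν x => exp (t • ρ (lam' x)) * W ν x * exp (-(t • ρ (lam' (x + e ν))))) = ℰ X W)
    (hf : ∀ X ∈ D, AnalyticOnNhd ℂ (fun A' : Λ → T → V => ℰ X (fun ν y => exp (ρ (A' ν y)))) (ball 0 α))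
    (hS : ∀ X ∈ D, ∀ A' ∈ ball (0 : Λ → T → V) α,
      ‖ℰ X (fun ν y => exp (ρ (A' ν y)))‖ ≤ g ^ κ₀ * Real.exp (-κ * Sy.dj X))
    (lam : ℕ → T → V) (c ℓ B : ℕ → Λ → T → V) (hc : ∀ z ∈ Z, ∀ ν y, lam z (y + e ν) - lam z y = c z ν y)
    (hcn : ∀ z ∈ Z, ‖c z‖ ≤ a * L ^ ((j : ℝ) - sc z)) (hlam : ∀ z ∈ Z, ‖lam z‖ ≤ a * L ^ ((j : ℝ) - sc z))
    (hℓ : ∀ z ∈ Z, ‖ℓ z‖ ≤ a * (L ^ ((j : ℝ) - sc z)) ^ 2)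
    (hrB : ∀ z ∈ Z, ‖B z - c z - ℓ z‖ ≤ a * (L ^ ((j : ℝ) - sc z)) ^ 2) (hBα : ∀ z ∈ Z, ‖B z‖ ≤ α / 2)
    (r : Sy.Dom → ℝ)
    (hrX : ∀ X ∈ D,
      |r X| ≤ ‖ℰ X (fun ν y => exp (ρ (B (zOf X) ν y))) - ℰ X (fun ν y => exp (ρ ((0 : Λ → T → V) ν y)))‖)
    {γ : ℕ → ℝ} (hcount : ∀ n, ((Z.filter (fun z => sc z = n)).card : ℝ) ≤ (L ^ ((n : ℝ) - j)) ^ (4 : ℝ) * γ n) :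
    ∃ (Z' : Finset ℕ) (sc' : ℕ → ℕ) (t : ℕ → ℝ), ∑ X ∈ D, r X = ∑ z ∈ Z', t z ∧
      (∀ z ∈ Z', j ≤ sc' z ∧ sc' z ≤ k) ∧
      (∀ z ∈ Z', |t z| ≤ (C * K₀ c₀ Δ * g ^ κ₀) * (L ^ ((j : ℝ) - sc' z)) ^ (4 : ℝ)) ∧
      (∀ n, ((Z'.filter (fun z => sc' z = n)).card : ℝ) ≤ (L ^ ((n : ℝ) - j)) ^ (4 : ℝ) * γ n) := by
  have hC0 : 0 ≤ C := (chartPoly_nonneg ha hb0 hα).trans hC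
  have hL0 : 0 < L := lt_of_lt_of_le one_pos hL
  refine rep244Clause_of_assignment G hΔ hV hκ hC0 hL0 hg D zOf Z hZ sc hsc cz hcz r (fun X hX => ?_) hcount
  have hz : zOf X ∈ Z := hZ X hX
  have hσ0 : 0 ≤ L ^ ((j : ℝ) - sc (zOf X)) := Real.rpow_nonneg hL0.le _
  have hσ1 : L ^ ((j : ℝ) - sc (zOf X)) ≤ 1 := by
    apply Real.rpow_le_one_of_one_le_of_nonpos hL
    have : (j : ℝ) ≤ sc (zOf X) := by exact_mod_cast (hsc _ hz).1
    linarith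
  exact domainTerm_le_of_chart eV e ρ hρ (hℰ X hX) (h47 X hX) hα hg (hf X hX) (hS X hX) hb0 hb (lam (zOf X))
    (c (zOf X)) (ℓ (zOf X)) (B (zOf X)) (hc _ hz) ha hσ0 hσ1 (hcn _ hz) (hlam _ hz) (hℓ _ hz) (hrB _ hz) (hBα _ hz)
    hC (hrX X hX)

end Chart

/-! ## §4. (2.44) for a run, and the 𝐑-conjunct of Theorem 2 for a family of runs, from the point data -/

/-- **(2.44) for one run** from `PointDataR` with the constant of §1/§3: `B14Thm2.Ineq244 S (C·K₀(c₀,Δ)) κ₀`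
(`…Thm2Assembly.ineq244_of_pointDataR`, i.e. `B14Sect3.ineq244_of_rep244`; `g_j ≥ 0`). [cite: Balaban1988Convergent, (2.44) p.263, p.283] -/
theorem ineq244_of_domainBounds (S : B14.Sect2Data) {Δ : ℕ} {c₀ κ C L : ℝ} {κ₀ : ℕ} (hC : 0 ≤ C)
    (hL : 0 < L) (hg : ∀ j, 0 ≤ S.flow.g j)
    (h : ∀ j k ω, 1 ≤ j → j ≤ k → k ≤ S.K →
      ∃ (Sy : LocDomainSys) (G : CubeSystem Sy) (_ : G.DegreeLE Δ) (_ : G.VolumeLeaf c₀) (_ : kappa₀ c₀ Δ ≤ κ)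
        (Z : Finset ℕ) (sc : ℕ → ℕ) (cz : ℕ → G.Cube) (A : ℕ → Finset Sy.Dom) (r : ℕ → Sy.Dom → ℝ),
        S.rTerm j k ω = ∑ z ∈ Z, ∑ X ∈ A z, r z X ∧ (∀ z ∈ Z, j ≤ sc z ∧ sc z ≤ k) ∧
        (∀ z ∈ Z, A z ⊆ G.above (cz z)) ∧
        (∀ z ∈ Z, ∀ X ∈ A z,
          |r z X| ≤ C * (L ^ ((j : ℝ) - sc z)) ^ 4 * (S.flow.g j) ^ κ₀ * Real.exp (-κ * Sy.dj X)) ∧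
        (∀ n, ((Z.filter (fun z => sc z = n)).card : ℝ) ≤ (L ^ ((n : ℝ) - j)) ^ (4 : ℝ) * S.gammaVol n ω)) :
    B14Thm2.Ineq244 S (C * K₀ c₀ Δ) κ₀ :=
  Thm2Assembly.ineq244_of_pointDataR S hL (mul_nonneg hC (K₀_pos c₀ Δ).le) hg
    (pointDataR_of_domainBounds S hC hL hg h)

/-- **(2.44) for one run, assignment form** (`pointDataR_of_assignments` + `B14Sect3.ineq244_of_rep244`).
[cite: Balaban1988Convergent, (2.44) p.263, p.283] -/
theorem ineq244_of_assignments (S : B14.Sect2Data) {Δ : ℕ} {c₀ κ C L : ℝ} {κ₀ : ℕ} (hC : 0 ≤ C)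
    (hL : 0 < L) (hg : ∀ j, 0 ≤ S.flow.g j)
    (h : ∀ j k ω, 1 ≤ j → j ≤ k → k ≤ S.K →
      ∃ (Sy : LocDomainSys) (G : CubeSystem Sy) (_ : G.DegreeLE Δ) (_ : G.VolumeLeaf c₀) (_ : kappa₀ c₀ Δ ≤ κ)
        (D : Finset Sy.Dom) (zOf : Sy.Dom → ℕ) (Z : Finset ℕ) (sc : ℕ → ℕ) (cz : ℕ → G.Cube) (r : Sy.Dom → ℝ),
        S.rTerm j k ω = ∑ X ∈ D, r X ∧ (∀ X ∈ D, zOf X ∈ Z) ∧ (∀ z ∈ Z, j ≤ sc z ∧ sc z ≤ k) ∧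
        (∀ X ∈ D, cz (zOf X) ∈ G.cubes X) ∧
        (∀ X ∈ D, |r X| ≤ C * (L ^ ((j : ℝ) - sc (zOf X))) ^ 4 * (S.flow.g j) ^ κ₀ * Real.exp (-κ * Sy.dj X)) ∧
        (∀ n, ((Z.filter (fun z => sc z = n)).card : ℝ) ≤ (L ^ ((n : ℝ) - j)) ^ (4 : ℝ) * S.gammaVol n ω)) :
    B14Thm2.Ineq244 S (C * K₀ c₀ Δ) κ₀ :=
  Thm2Assembly.ineq244_of_pointDataR S hL (mul_nonneg hC (K₀_pos c₀ Δ).le) hg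
    (pointDataR_of_assignments S hC hL hg h)

/-- **The 𝐑-conjunct of Theorem 2 for a FAMILY of runs** («there exists an absolute constant R₁ such, that … (2.44)»,
`R₁` BEFORE the run index as in `B14.Thm2Printed`): if every run of the family carries `PointDataR` with the SAME
constant `c′` (e.g. `c′ = C·K₀(c₀, Δ)` from §1/§3 with letters uniform over the family) and nonnegative couplings, then
ONE `R₁ = c′` bounds the left-hand side of (2.44) for every run and every triple. [cite: Balaban1988Convergent, Thm 2 (2.44) p.263] -/
theorem thm2_Rconjunct_of_pointDataR {I : Type} (fam : I → B14.Sect2Data) {L c' : ℝ} {κ₀ : ℕ} (hL : 0 < L)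
    (hc' : 0 ≤ c') (hg : ∀ i j, 0 ≤ (fam i).flow.g j) (h : ∀ i, Thm2Assembly.PointDataR (fam i) L c' κ₀) :
    ∃ R₁ : ℝ, ∀ i : I, ∀ j k ω, 1 ≤ j → j ≤ k → k ≤ (fam i).K →
      |(fam i).rTerm j k ω| ≤ R₁ * ((fam i).flow.g j) ^ κ₀ * ∑ n ∈ Finset.Icc j k, (fam i).gammaVol n ω :=
  ⟨c', fun i => Thm2Assembly.ineq244_of_pointDataR (fam i) hL hc' (hg i) (h i)⟩

end Literature.MathematicalPhysics.QuantumFieldTheory.Balaban1983to89.B14.Ineq244ChartFeed
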